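import Summits.QuantumFields.YangMills.Theorems.BalabanUVNodesN08Constructed

/-!
# Route «BalabanUVNodes», Track-A DAG node N08 = [Balaban1985UV3] Thm 1 p. 257 ∕ Thm 2 p. 272 — THE (α) CLAUSE OF THE d = 3 LANE
# SPLIT BY SPECIES (part 1 of 2: the SCHEMAS): the cluster-expansion DATA of (41)∕(47) as ONE displayed hypothesis schema, the four
# CLASS-I rows `hU ∕ h44 (+ floor) ∕ hLF67 ∕ h68` verbatim, the definitional split of `RunAlpha`, and the in-edges' printed statements
# ([7] (2)∕(3), the history's large-field condition, (44)'s loop input) given BODIES on the lane's own carriers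

Cell `pub-ymgap`, seat `pub-ymgap-dag-n08-d` gen 0 (director-ym R134 row «CLASS-I in-edge conclusions at the (α) granularity of `RunAlpha`: type the
cluster-expansion DATA (41)∕(47) as hypothesis schema and discharge the species-OK interfaces `h68 ∕ hU ∕ h44 ∕ hLF67`»; census of record
`HOME/pub-ymgap-dag-n08-b/N08-ALPHA-ROWS.md` 6a78a4e68c218d11 §2; HUMAN RULING D-0062; chair R424 venue).  `bears_on: R4∕N08`; filed `--supports
stmt-QuantumFields-19674` (K1 `StabilityBAtRecordR11e`).  Sorry-free, standard axioms.  The declarations of this part are hypothesis SCHEMAS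
(`structure … : Prop`), one record of NAMES (`OldTermSizes`) and three `def … : Prop` giving printed sentences a body at the lane's objects —
nothing of the paper is asserted; part 2 (`BalabanUVNodesN08AlphaClassIDischarge`) carries the discharges and the N08 closers.

WHAT THE (α) CLAUSE IS.  The `pub-balaban3d` lane proves [Balaban1985UV3] Thm 1 (compact reading) ∧ Thm 2 for its CONSTRUCTED densities
(`UVStability3DInputs.uvStability3D_of_inputs`) and hence N08 at the C-binding of record over that family (`BalabanUVNodesN08Constructed`,
T4 of seat n08-a, p411652) from ONE displayed clause per lattice approximation, `UVStability3DInputs.RunAlpha 𝔊 𝔠 X 𝔖 𝔄` (per step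
`StepAlpha`).  The census sorts its rows by species: CLASS II = content of [B10] and of its «method» citations [8]–[10] (the cluster expansion:
`h324c`, `chart`, `inv26`, `far_le`, the representation half of `hG`, `fibre49`, `fibre57Low`, `𝔄.Λc`, `𝔄.N45`) — THE OBJECT GAP of N08;
CLASS III = structural ∕ tree theorems at print's pin; CLASS I = CONCLUSIONS OF IN-EDGES OF N08 as typed dependency interfaces: `hU` and
`h68` ([7] = in-edge b11, Thm 1: the minimizer and its regularity (8)), `h44` ([4] = b7 (50)∕(53) + b11 regularity, through (43)), `hLF67`
(b11: the constraint (42) = [7] (3), composed with the history's large-field condition).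

CONTENTS (count-neutral kernel bookkeeping; the (α) rows stay HYPOTHESES about the lane's free objects `X`, `𝔖`, `𝔄`):
* §0 `OldTermSizes` — NAMES for the sizes print's (43) is written in: `|𝒫_j(Y_j)|` (coefficient) and `|B_k(c)|` (loop variable).
* §1 THE DATA SCHEMA: `StepDataRows k` = `StepAlpha k` with the three class-I rows `hU`, `h44`, `hfloor` REMOVED (21 rows verbatim);
  `OldTermForm 𝔏 k` = (43) p. 266 AS PRINTED for the data's previous-scale terms (`B10SectCExpansion.Shape43` of the coefficient sizes —
  decay and the degree floor «n ≥ 2» — and the multilinear evaluation `|𝒫_j(Y_j, U_k)| ≤ |𝒫_j(Y_j)|·Π_i|B_k(c_i)|`); `RunDataRows 𝔏` = both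
  for every step `k < K`.
* §2 THE CLASS-I ROWS VERBATIM (`StepRowsI k` = `hU`, `h44`, `hfloor`; `RunRowsI` = these + `hLF67`, `h68`) and the definitional split
  `stepAlpha_iff` ∕ `runAlpha_iff : RunAlpha ↔ (∀ k < K, StepDataRows k) ∧ RunRowsI`.
* §3 THE IN-EDGE FACES WITH BODY on the lane's carriers (the ℤ³ lift `LiftBridge.liftCfg` of the composite minimizer `X.UkH k h U`, [4]'s
  average `B7Prop2Explicit.avgIter`, the regions `Carriers.Omega ∕ Lam` of the history): `RegLift` = the scale-`j` plaquette clause of [7]'s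
  regular space (2) «|U(∂p) − 1| < θL^{−2j}, p ∈ Ω_j» (torus twin: `B10Eq68TorusRegularity.RegAt`); `InB42Lift` = [7] (3) = [B10] (42)∕(67)
  «Ū^j = V_j on Λ_j» for the recorded scales (torus twin: `B10Eq42TorusConstraint.Constraint42`); `HLarge` = the history's large-field
  condition «|V_j(∂p′) − 1| ≥ g_jp(g_j)» (p. 273 L13) on the field history; the schema `InEdgeFaces 𝔏` (`measUk`, `loop28`, `inB42`, `reg2`).
HONEST FRAMING: count-neutral; CLASS II stays DISPLAYED (it is the cluster expansion of [B10]∕[8]–[10], not an in-edge and not a tree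
theorem); the faces of §3 are print's [7]∕[4] sentences AT THE LANE'S FREE OBJECT `X.UkH` — the PIN of `X.UkH` to [7]'s minimizer and of
`B11.Thm1Printed`'s abstract family to these bodies is NODE 00's act, not claimed here; `measUk` («U_k(·,h) measurable», [7] Thm 1 + Prop 9)
is NOT a displayed statement of [7] and stays a face (census row I*); `loop28` is (44)'s regularity input about the NAMED loop sizes (its
derivation from (8) needs (43)'s loop variables pinned to `B10Eq27TorusAxialLog.B27` of the averaged minimizer — the torus modules
`B10Eq44Concrete ∕ OnDomain ∕ SpecialUnitary` do it there).  d = 3 lattice gauge theory on finite tori as printed; nothing about d = 4, the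
continuum, OS axioms, a mass gap or the Clay problem.
-/

noncomputable section

namespace Summit.QuantumFields.YangMills.Theorems.BalabanUVNodesN08AlphaClassI

open MeasureTheory Metric
open scoped BigOperators Matrix.Norms.L2Operator
open Literature.MathematicalPhysics.QuantumFieldTheory.Balaban1983to89
open Literature.MathematicalPhysics.QuantumFieldTheory.Balaban1983to89.B10
open Literature.MathematicalPhysics.QuantumFieldTheory.Balaban1983to89.B10SectCExpansion (Shape43 Bound44 TermSizes)
open Literature.MathematicalPhysics.QuantumFieldTheory.Balaban1983to89.B10Eq24Cumulant (chiMeasure)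
open Literature.MathematicalPhysics.QuantumFieldTheory.Balaban1983to89.TreeLengthTorus (tsys)
open Literature.MathematicalPhysics.QuantumFieldTheory.Balaban1985CMP102
open Literature.MathematicalPhysics.QuantumFieldTheory.Balaban1985CMP102.Setting
open Literature.MathematicalPhysics.QuantumFieldTheory.Balaban1985CMP102.Binders
  (ChartAnalyticityAsCited FarTermsDecayAsCited Norm35StepAsCited LogZTExtensiveAsCited GraphRep23AsCited)
open Summit.QuantumFields.Balaban3D.Carriers
open Summit.QuantumFields.Balaban3D.Proofs.Inputs
open Summit.QuantumFields.Balaban3D.Proofs.Primitives (AlphaConsts)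
open Summit.QuantumFields.Balaban3D.Proofs.GroupModelLieC (lieC)
open Summit.QuantumFields.Balaban3D.Proofs.UVStability3DInputs
open Summit.QuantumFields.Balaban3D.Proofs.Representation33 (jet26)
open Summit.QuantumFields.Balaban3D.Proofs.Bound55Std (Fibre49 Fibre57Low)
open Summit.QuantumFields.Balaban3D.Proofs.LiftBridge (liftCfg)
open Summit.QuantumFields.Balaban3D.Proofs.Run3SmallFactors (codeZ)
open Summit.QuantumFields.Balaban3D.Proofs.TorusLift (projSite)
open B7Prop1Explicit (hol plaqWord e)
open B7Prop1Local (pdevOn loK plaqHiK)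
open B7Prop2Explicit (avgIter)

variable {L : ℕ}

/-! ## §0 Names for the sizes of (43) -/

/-- **THE SIZES (43) IS WRITTEN IN** (NAMES only, free data like `Carriers.StepSeries.oldVal`): per step `k → k+1`, history `h`, field `U` and old
scale `j`, the coefficient sizes `coef … y n c = |𝒫_j(Y_j)|`, `Y_j = (y, c₁, …, c_n)`, and the loop-variable sizes `loop … y c = |B_k(c)|`,
`B_k(c) = (1/i) log Ū_k^j(Γ_{y,c₋} ∪ c ∪ Γ_{c₊,y})`, over the lane's old-term geometry `Carriers.oldGeom`. [cite: Balaban1985UV3, (43) p.266] -/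
structure OldTermSizes (S : Scales L) (G : Type) where
  /-- `|𝒫_j(Y_j)|` of (43) -/
  coef : (k : ℕ) → Hist S.P (k + 1) → GaugeField S.P (k + 1) G → (j : ℕ) → TermSizes (oldGeom S.P k j)
  /-- `|B_k(c)|` of (43), per block `y` and bond `c` -/
  loop : (k : ℕ) → Hist S.P (k + 1) → GaugeField S.P (k + 1) G → (j : ℕ) → (oldGeom S.P k j).Site → (oldGeom S.P k j).Bond → ℝ

/-! ## §1 The cluster-expansion DATA schema (classes II + III of the census), displayed -/

section Schema

variable {S : Scales L} {G : Type} [GaugeGroup G] [MeasurableSpace G] [HaarData G] (𝔊 : GroupModel G) (𝔠 : AlphaConsts L 𝔊.N)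
  (X : ExternalInputs S G) (𝔖 : ∀ k, StepSeries S G ↥(lieC 𝔊) (nblkOf S 𝔠.lane.carrier k) k) (𝔄 : AlphaData 𝔊 𝔠 X 𝔖)
  (𝔏 : OldTermSizes S G)

open Classical in
/-- **THE CLUSTER-EXPANSION DATA OF STEP `k → k+1`, DISPLAYED**: `UVStability3DInputs.StepAlpha k` with its three CLASS-I rows `hU` ([7] Thm 1:
measurability of `U_k(·,h)`), `h44` ((44) p. 267) and `hfloor` («n ≥ 2») REMOVED — the GAP binders G3D-01∕02∕04∕05∕06 «as cited», the displays (26),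
(28), [B1] (3.24)(a)(c), the identifications R-ACT ∕ batch 11 (a), the regularity of the data, and the residual rows R3D-01∕02, verbatim.  HYPOTHESES;
nothing asserted. [cite: Balaban1985UV3, (23)–(33) pp.262–264 + (55)–(63) pp.269–272] -/
structure StepDataRows (k : ℕ) : Prop where
  /-- the Gaussian measure of (58) is a probability measure -/
  hμ : IsProbabilityMeasure (𝔖 k).μ
  /-- the small-field box is measurable -/
  hboxm : ∀ h, MeasurableSet ((𝔖 k).box h)
  /-- … of positive measure -/
  hbox : ∀ h, (𝔖 k).μ ((𝔖 k).box h) ≠ 0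
  /-- the effective potential is a.e.-measurable -/
  hVm : ∀ h U, AEMeasurable ((𝔖 k).𝒱 h U) (𝔖 k).μ
  /-- … and bounded on the box -/
  hVB : ∀ h U, ∀ ω ∈ (𝔖 k).box h, |(𝔖 k).𝒱 h U ω| ≤ 𝔄.Bv k
  /-- G3D-01 at the (25)-rate (R-ACT) -/
  chart : ∀ Y, ChartAnalyticityAsCited ((𝔖 k).Ψ Y) 𝔠.ρ
    (𝔠.C25 * S.gk k * Real.exp (-(𝔠.κ * (tsys 3 (nblkOf S 𝔠.lane.carrier k)).dj Y)))
  /-- (28) p. 263 -/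
  bound28 : ∀ Y h U, ‖(𝔖 k).Bcfg Y h U‖ ≤ 𝔠.cB * (rFun 𝔠.r₀ (S.gk k) * S.gk k * pFun 𝔠.b₀ 𝔠.p₀ (S.gk k))
  /-- (26) in the chart space, for the adjoint action -/
  inv26 : ∀ Y (U : G), ∀ b ∈ ball (0 : (𝔖 k).E) 𝔠.ρ, adjAct 𝔊 (P := S.P) k U b ∈ ball (0 : (𝔖 k).E) 𝔠.ρ →
    (𝔖 k).Ψ Y (adjAct 𝔊 (P := S.P) k U b) = (𝔖 k).Ψ Y b
  /-- G3D-06 -/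
  far_le : FarTermsDecayAsCited (𝔖 k).far
    (fun Y => 𝔠.C25 * S.gk k * Real.exp (-(𝔠.κ * (tsys 3 (nblkOf S 𝔠.lane.carrier k)).dj Y)))
    𝔠.Cfar (S.gk k ^ 7 * (rFun 𝔠.r₀ (S.gk k) * pFun 𝔠.b₀ 𝔠.p₀ (S.gk k)) ^ 7)
  /-- identification of `PY` with the retained jet (batch 11 (a)) -/
  hPY : ∀ h U, (𝔖 k).PY h U
    = ∑ Y ∈ (𝔖 k).loc (ΩblkOf 𝔠.lane.carrier.M₁ (rcolOf S 𝔠.lane.carrier) (nblkOf S 𝔠.lane.carrier k)) (rretOf S 𝔠.lane.carrier k) h,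
        ((jet26 ((𝔖 k).Ψ Y) ((𝔖 k).Bcfg Y h U)).re - (𝔖 k).far Y h U)
  /-- identification of `PYZ` with the retained jet of the G3D-07 pieces -/
  hPYZ : ∀ h U, (𝔖 k).PYZ h U
    = ∑ Y ∈ (𝔖 k).loc (ΩblkOf 𝔠.lane.carrier.M₁ (rcolOf S 𝔠.lane.carrier) (nblkOf S 𝔠.lane.carrier k)) (rretOf S 𝔠.lane.carrier k) h,
        ((jet26 ((𝔄.Λc k).Ψ Y) ((𝔖 k).Bcfg Y h U)).re - (𝔄.Λc k).far Y h U)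
  /-- G3D-04 -/
  norm35 : Norm35StepAsCited (pieces 𝔠.lane X 𝔖 k) 𝔠.c35 𝔠.a35 𝔠.cv 𝔠.cJ35
  /-- G3D-05 -/
  logZT : LogZTExtensiveAsCited (pieces 𝔠.lane X 𝔖 k) 𝔠.cT 𝔠.aT 𝔠.cn 𝔠.cJT
  /-- R-ACT: the graph carrier's activities are the chart activities -/
  hact : ∀ h Y U, ((𝔖 k).Gt h).activities.act Y U = (𝔖 k).act h Y U
  /-- G3D-02 -/
  hG : ∀ h, GraphRep23AsCited ((𝔖 k).Gt h) (fun U => ∑ n ∈ Finset.Icc 1 𝔠.nbar, (𝔖 k).cum h U n / (n.factorial : ℝ))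
    (𝔄.C₂₃ k) (𝔄.c₂₃ k) (𝔄.M₂₃ k) (𝔄.δ₀ k)
  /-- [B1] (3.24) input (a), in the unit `(L^kg₀²)^{3+κ₀}|T₁^{(k)}|` -/
  h324a : ∀ h (U : GaugeField S.P (k + 1) G), |Real.log ((𝔖 k).μ.real ((𝔖 k).box h))| ≤
    𝔠.Ca * ((L : ℝ) ^ k * S.g0sq) ^ (3 + 𝔠.κ₀) * S.sites k
  /-- [B1] (3.24) input (c) -/
  h324c : ∀ h U, ∀ t ∈ Set.Icc (0 : ℝ) 1, |iteratedDeriv (𝔠.nbar + 1) (ProbabilityTheory.cgf ((𝔖 k).𝒱 h U)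
    (chiMeasure (𝔖 k).μ (((𝔖 k).box h).indicator fun _ => (1 : ℝ)))) t| ≤
      𝔠.Cc * ((𝔠.nbar + 1).factorial : ℝ) * ((L : ℝ) ^ k * S.g0sq) ^ (3 + 𝔠.κ₀) * S.sites k
  /-- data regularity: the interaction sum `Pint k h` of (43) (DEFINED from the activities) is measurable in `U` … -/
  hPm : ∀ h : Hist S.P k, Measurable ((inputOf 𝔠.lane X 𝔖).Pint k h)
  /-- … and bounded above -/
  hPb : ∀ (h : Hist S.P k) (U : GaugeField S.P k G), (inputOf 𝔠.lane X 𝔖).Pint k h U ≤ 𝔄.cP k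
  /-- RESIDUAL R3D-01 (p4): «The integral (49)» ≤ (55)·(58), per new history -/
  fibre49 : ∀ h' : Hist S.P (k + 1), Fibre49 X 𝔠.lane.carrier 𝔖 (fun _ => True) k (piecesW 𝔠.lane X 𝔖 k) h'
  /-- RESIDUAL R3D-02 (p4): the lower step bound at the trivial history -/
  fibre57Low : Fibre57Low X 𝔠.lane.carrier 𝔖 (fun _ => True) k (piecesW 𝔠.lane X 𝔖 k)

/-- **(43) p. 266 AS PRINTED, for the data's previous-scale terms** (the form behind the display (44)): «𝒫_j(Y_j, U_k) = ⟨𝒫_j(Y_j), B_k(c₁), …,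
B_k(c_n)⟩, n ≥ 2, … |𝒫_j(Y_j)| ≤ O(1) Π_{i=1}^n exp(−κ₁(M₁L^jη)^{−1}|c_{i,−} − y|)» — the coefficient sizes satisfy `B10SectCExpansion.Shape43`
(decay, and the degree floor «Of course the condition n ≥ 2 plays a crucial role», p. 267), and the evaluated term is bounded multilinearly
by the loop sizes.  DATA rows (the 𝒫_j are the cluster expansion's output); hypotheses, nothing asserted. [cite: Balaban1985UV3, (43) p.266] -/
structure OldTermForm (k : ℕ) : Prop where
  /-- (43): decay of the coefficient sizes and the degree floor «n ≥ 2» -/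
  shape43 : ∀ (h : Hist S.P (k + 1)) (U : GaugeField S.P (k + 1) G), ∀ j ∈ Finset.Icc 1 k,
    Shape43 (oldGeom S.P k j) (𝔏.coef k h U j) 𝔠.κ₁ (𝔠.M₁ : ℝ) (ell S.P k j) 𝔠.C44
  /-- loop sizes are sizes -/
  loop_nonneg : ∀ (h : Hist S.P (k + 1)) (U : GaugeField S.P (k + 1) G), ∀ j ∈ Finset.Icc 1 k,
    ∀ (y : (oldGeom S.P k j).Site) (b : (oldGeom S.P k j).Bond), 0 ≤ 𝔏.loop k h U j y b
  /-- (43): `|𝒫_j(Y_j, U_k)| = |⟨𝒫_j(Y_j), B_k(c₁), …, B_k(c_n)⟩| ≤ |𝒫_j(Y_j)|·Π_i|B_k(c_i)|` -/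
  mult43 : ∀ (h : Hist S.P (k + 1)) (U : GaugeField S.P (k + 1) G), ∀ j ∈ Finset.Icc 1 k,
    ∀ (y : Site S.P j) (n : ℕ) (c : Fin n → PBond S.P j),
      |(𝔖 k).oldVal h U j y n c| ≤ |𝔏.coef k h U j y n c| * ∏ i, 𝔏.loop k h U j y (c i)

/-- **THE CLUSTER-EXPANSION DATA OF ONE LATTICE APPROXIMATION, DISPLAYED**: for every step `k < K` the data schema `StepDataRows k` and the (43)-form
`OldTermForm 𝔏 k`.  The honest «ESTIMATE ASSUMED AS ADMISSIBILITY» list of N08 at the (α) granularity (census §3). [cite: Balaban1985UV3, (41) p.266 + (47) p.267 + (43) p.266] -/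
structure RunDataRows : Prop where
  /-- the data schema per step -/
  steps : ∀ k, k + 1 ≤ S.K → StepDataRows 𝔊 𝔠 X 𝔖 𝔄 k
  /-- (43) per step -/
  form43 : ∀ k, k + 1 ≤ S.K → OldTermForm 𝔊 𝔠 𝔖 𝔏 k

/-! ## §2 The CLASS-I rows verbatim (the typed dependency interfaces) and the definitional split of `RunAlpha` -/

/-- **THE CLASS-I ROWS OF STEP `k → k+1`, VERBATIM**: `hU` ([7] Thm 1: «U_k(·,h) measurable»), `h44` ((44) p. 267 on the previous-scale terms),
`hfloor` («n ≥ 2»). [cite: Balaban1985UV3, (44) p.267 + (42) p.266] -/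
structure StepRowsI (k : ℕ) : Prop where
  /-- EXTERNAL-input property ([7] Thm 1): the composite minimizer map `U_k(·, h)` is measurable -/
  hU : ∀ h : Hist S.P k, Measurable (X.UkH k h)
  /-- (44) p. 267 on the previous-scale terms of the data -/
  h44 : ∀ (h : Hist S.P (k + 1)) (U : GaugeField S.P (k + 1) G), ∀ j ∈ Finset.Icc 1 k,
    Bound44 (oldGeom S.P k j) (fun y n c => (𝔖 k).oldVal h U j y n c) 𝔠.κ₁ (𝔠.M₁ : ℝ) (ell S.P k j) (L : ℝ) 𝔠.B₃
      (S.gk k) (pFun 𝔠.b₀ 𝔠.p₀ (S.gk k)) 𝔠.C44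
  /-- the degree floor «n ≥ 2» of (43) for the previous-scale terms -/
  hfloor : ∀ (h : Hist S.P (k + 1)) (U : GaugeField S.P (k + 1) G), ∀ j ∈ Finset.Icc 1 k,
    ∀ (y : Site S.P j) (n : ℕ) (c : Fin n → PBond S.P j), (𝔖 k).oldVal h U j y n c ≠ 0 → 2 ≤ n

/-- **THE CLASS-I ROWS OF THE RUN, VERBATIM**: the step rows for `k < K`, and the displays (67)∘large field (`hLF67`) and (68) (`h68`) about the
lifted composite minimizers. [cite: Balaban1985UV3, (67)–(68) p.273] -/
structure RunRowsI : Prop where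
  /-- the step rows -/
  steps : ∀ k, k + 1 ≤ S.K → StepRowsI 𝔊 𝔠 X 𝔖 k
  /-- (67) ∘ the large-field characteristic function of the history, on the averaged lifted minimizers -/
  hLF67 : ∀ k, k ≤ S.K → ∀ (h : Hist S.P k), Hist.Admissible 𝔠.lane.carrier.M₁ (rcolOf S 𝔠.lane.carrier) k h →
    ∀ (U : GaugeField S.P k G), ∀ e ∈ Hist.disc h, S.gk e.1 * pFun 𝔠.lane.carrier.b₀ 𝔠.lane.carrier.p₀ (S.gk e.1) ≤
      ‖((hol (avgIter L (liftCfg 𝔊 (X.UkH k h U)) e.1) (codeZ e) (plaqWord e.2.2.1 e.2.2.2) :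
          (Matrix (Fin 𝔊.N) (Fin 𝔊.N) ℂ)ˣ) : Matrix (Fin 𝔊.N) (Fin 𝔊.N) ℂ) - 1‖
  /-- (68) on the lifted minimizers -/
  h68 : ∀ k, k ≤ S.K → ∀ (h : Hist S.P k), Hist.Admissible 𝔠.lane.carrier.M₁ (rcolOf S 𝔠.lane.carrier) k h →
    ∀ (U : GaugeField S.P k G), ∀ e ∈ Hist.disc h,
      pdevOn (loK L e.1 (codeZ e)) (plaqHiK L e.1 (codeZ e) e.2.2.1 e.2.2.2) (liftCfg 𝔊 (X.UkH k h U)) <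
        𝔠.C68 * (S.gk e.1 * pFun 𝔠.lane.carrier.b₀ 𝔠.lane.carrier.p₀ (S.gk e.1)) * (((L : ℝ) ^ e.1)⁻¹) ^ 2

/-- **THE SPLIT OF A STEP**: `StepAlpha k` IS «data schema ∧ class-I rows» (definitional repackaging). [cite: Balaban1985UV3, (41) p.266 (bookkeeping)] -/
theorem stepAlpha_iff (k : ℕ) : StepAlpha 𝔊 𝔠 X 𝔖 𝔄 k ↔ StepDataRows 𝔊 𝔠 X 𝔖 𝔄 k ∧ StepRowsI 𝔊 𝔠 X 𝔖 k := by
  constructor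
  · intro A
    exact ⟨⟨A.hμ, A.hboxm, A.hbox, A.hVm, A.hVB, A.chart, A.bound28, A.inv26, A.far_le, A.hPY, A.hPYZ, A.norm35, A.logZT, A.hact,
        A.hG, A.h324a, A.h324c, A.hPm, A.hPb, A.fibre49, A.fibre57Low⟩, ⟨A.hU, A.h44, A.hfloor⟩⟩
  · rintro ⟨D, I⟩
    exact ⟨D.hμ, D.hboxm, D.hbox, D.hVm, D.hVB, D.chart, D.bound28, D.inv26, D.far_le, D.hPY, D.hPYZ, D.norm35, D.logZT, D.hact,
      D.hG, D.h324a, D.h324c, I.h44, I.hfloor, I.hU, D.hPm, D.hPb, D.fibre49, D.fibre57Low⟩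

/-- **THE SPLIT OF THE RUN**: `RunAlpha` IS «(∀ k < K, data schema) ∧ class-I rows». [cite: Balaban1985UV3, (41) p.266 (bookkeeping)] -/
theorem runAlpha_iff : RunAlpha 𝔊 𝔠 X 𝔖 𝔄 ↔ (∀ k, k + 1 ≤ S.K → StepDataRows 𝔊 𝔠 X 𝔖 𝔄 k) ∧ RunRowsI 𝔊 𝔠 X 𝔖 := by
  constructor
  · intro R
    exact ⟨fun k hk => ((stepAlpha_iff 𝔊 𝔠 X 𝔖 𝔄 k).1 (R.steps k hk)).1,
      ⟨fun k hk => ((stepAlpha_iff 𝔊 𝔠 X 𝔖 𝔄 k).1 (R.steps k hk)).2, R.hLF67, R.h68⟩⟩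
  · rintro ⟨D, I⟩
    exact ⟨fun k hk => (stepAlpha_iff 𝔊 𝔠 X 𝔖 𝔄 k).2 ⟨D k hk, I.steps k hk⟩, I.hLF67, I.h68⟩

end Schema

/-! ## §3 The in-edge faces WITH BODY on the lane's carriers -/

section Faces

variable (S : Scales L) {N : ℕ}

/-- **[7] (2), THE SCALE-`j` PLAQUETTE CLAUSE OF THE REGULAR SPACE `U_k({Ω_j}, ε₀)` WITH BODY on the ℤ³ lift** ([7] p. 278: «|U(∂p) − 1| <
ε₀L^{−2j} = ε₀η²(L^jη)^{−2} for p ∈ Ω_j»; «p ∈ Ω_j» read as «a corner of p in Ω_j», the cell's reading of [6] (1.7), `B8Ineq132.CondAt`): every unit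
plaquette of the periodic configuration `Ul` on `ηℤ³` one of whose corners projects into the torus region `Xs ⊂ T_η` has `|Ul(∂p) − 1| < θL^{−2j}`.
Torus twin: `B10Eq68TorusRegularity.RegAt`. [cite: Balaban1985Variational, (2) p.278] -/
def RegLift (j : ℕ) (Xs : Set (Site S.P 0)) (θ : ℝ)
    (Ul : B7Prop1Explicit.Site S.P.d → Fin S.P.d → (Matrix (Fin N) (Fin N) ℂ)ˣ) : Prop :=
  ∀ (x : B7Prop1Explicit.Site S.P.d) (μ ν : Fin S.P.d), μ ≠ ν →
    (projSite x ∈ Xs ∨ projSite (x + e μ) ∈ Xs ∨ projSite (x + e ν) ∈ Xs ∨ projSite (x + e μ + e ν) ∈ Xs) →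
      ‖((hol Ul x (plaqWord μ ν) : (Matrix (Fin N) (Fin N) ℂ)ˣ) : Matrix (Fin N) (Fin N) ℂ) - 1‖ < θ * (((L : ℝ) ^ j)⁻¹) ^ 2

/-- **[7] (3) = [B10] (42) ∕ (67) «Ū^j = V_j on Λ_j» WITH BODY on the ℤ³ lift, for the recorded scales `j < k` of the history `h`** ([7] p. 278:
«If p′ ⊂ Λ_j … all four bonds of ∂p′ belong to Λ_j»; a scale-`j` bond `(z, z + e_κ)` lies in `Λ_j(h)` when both end blocks do): the `j`-fold
average (42)–(43) of [4] (`B7Prop2Explicit.avgIter`) of `Ul` equals the field `V j` on every such bond.  The top clause `j = k` («V_k = V» on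
`Ω_k^{(k)}`) ties `U_k` to the current field and is not read by (67).  Torus twin: `B10Eq42TorusConstraint.Constraint42`.
[cite: Balaban1985UV3, (42) p.266 + (67) p.273] -/
def InB42Lift (M₁ : ℕ) (Rcol : ℕ → ℕ) {k : ℕ} (h : Hist S.P k)
    (Ul : B7Prop1Explicit.Site S.P.d → Fin S.P.d → (Matrix (Fin N) (Fin N) ℂ)ˣ)
    (V : ℕ → B7Prop1Explicit.Site S.P.d → Fin S.P.d → (Matrix (Fin N) (Fin N) ℂ)ˣ) : Prop :=
  ∀ j < k, ∀ (z : B7Prop1Explicit.Site S.P.d) (κ : Fin S.P.d),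
    projSite ((L ^ j) • z) ∈ Lam M₁ Rcol h j → projSite ((L ^ j) • (z + e κ)) ∈ Lam M₁ Rcol h j →
      avgIter L Ul j z κ = V j z κ

/-- **THE HISTORY'S LARGE-FIELD CONDITION ON THE FIELD HISTORY** (p. 273 L13 «Let us take a plaquette p′ ⊂ Λ_j and such that |V_j(∂p′) − 1| ≥
g_jp(g_j)»; the complement of the characteristic functions (40)): at every recorded large-field plaquette `(j, p′) ∈ P(h)` the field `V_j` is large.
Structural: it says which field histories the history `h` sums over. [cite: Balaban1985UV3, (40) p.266 + p.273 L13] -/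
def HLarge (b₀ p₀ : ℝ) {k : ℕ} (h : Hist S.P k) (V : ℕ → B7Prop1Explicit.Site S.P.d → Fin S.P.d → (Matrix (Fin N) (Fin N) ℂ)ˣ) : Prop :=
  ∀ e ∈ Hist.disc h, S.gk e.1 * pFun b₀ p₀ (S.gk e.1) ≤
    ‖((hol (V e.1) (codeZ e) (plaqWord e.2.2.1 e.2.2.2) : (Matrix (Fin N) (Fin N) ℂ)ˣ) : Matrix (Fin N) (Fin N) ℂ) - 1‖

variable {S} {G : Type} [GaugeGroup G] [MeasurableSpace G] [HaarData G] (𝔊 : GroupModel G) (𝔠 : AlphaConsts L 𝔊.N)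
  (X : ExternalInputs S G) (𝔖 : ∀ k, StepSeries S G ↥(lieC 𝔊) (nblkOf S 𝔠.lane.carrier k) k) (𝔄 : AlphaData 𝔊 𝔠 X 𝔖)
  (𝔏 : OldTermSizes S G)

/-- **THE IN-EDGE FACES OF N08 AT THE (α) GRANULARITY** — the class-I content as the in-edges PRINT it, with bodies at the lane's free objects:
`measUk` ([7] Thm 1 p. 279 with Prop 9 p. 309: the minimizer map `V ↦ U_k(V, h)` is measurable — census row I*, not a displayed statement of
[7]); `loop28` ((44)'s regularity input «|B_k(c_i)| ≤ (L^jη)^{−1}|c_{i,−} − y|·8L²B₃g p(g)(L^jη)²» — from U_k's regularity on Ω_k ([7] Thm 1 (8),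
in-edge b11) through [4] (50)∕(53) (in-edge b7) and the axial ladder (27)∕(28), tree `B10Eq27TorusAxialLog.norm_B27_le`); `inB42` ([7] (3) = (42)
for `U_k(h, U)` at an `h`-large field history — the space `𝔅_k(𝔅_k, V)` of [7] Thm 1 (8)); `reg2` (membership of `U_k(h, U)` in the scale-`j`
plaquette clauses of [7]'s (2)∕(8) over the regions `Ω_j(h)` at the level-`(j+1)` constant `C68·g_jp(g_j)`, `B10Eq68TorusRegularity` §4).
HYPOTHESES about `X.UkH` and the named sizes `𝔏`; nothing asserted. [cite: Balaban1985Variational, (2)–(3) p.278 + Thm 1 (8) p.279] -/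
structure InEdgeFaces : Prop where
  /-- [7] Thm 1 + Prop 9: `U_k(·, h)` is measurable (census I*) -/
  measUk : ∀ k, k + 1 ≤ S.K → ∀ h : Hist S.P k, Measurable (X.UkH k h)
  /-- (44)'s regularity input on the loop sizes ([7] (8) + [4] (50)∕(53) + (27)∕(28)) -/
  loop28 : ∀ k, k + 1 ≤ S.K → ∀ (h : Hist S.P (k + 1)) (U : GaugeField S.P (k + 1) G), ∀ j ∈ Finset.Icc 1 k,
    ∀ (y : (oldGeom S.P k j).Site) (b : (oldGeom S.P k j).Bond),
      𝔏.loop k h U j y b ≤ ((ell S.P k j)⁻¹ * (oldGeom S.P k j).dist ((oldGeom S.P k j).cminus b) y) *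
        (8 * (L : ℝ) ^ 2 * 𝔠.B₃ * S.gk k * pFun 𝔠.b₀ 𝔠.p₀ (S.gk k) * ell S.P k j ^ 2)
  /-- [7] (3) = (42): `U_k(h, U)` lies in the constraint space of an `h`-large field history -/
  inB42 : ∀ k, k ≤ S.K → ∀ (h : Hist S.P k), Hist.Admissible 𝔠.lane.carrier.M₁ (rcolOf S 𝔠.lane.carrier) k h →
    ∀ (U : GaugeField S.P k G), ∃ V : ℕ → B7Prop1Explicit.Site S.P.d → Fin S.P.d → (Matrix (Fin 𝔊.N) (Fin 𝔊.N) ℂ)ˣ,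
      HLarge S 𝔠.lane.carrier.b₀ 𝔠.lane.carrier.p₀ h V ∧
        InB42Lift S 𝔠.lane.carrier.M₁ (rcolOf S 𝔠.lane.carrier) h (liftCfg 𝔊 (X.UkH k h U)) V
  /-- [7] (2)∕(8): `U_k(h, U)` satisfies the scale-`j` plaquette clauses over `Ω_j(h)` at the constant `C68·g_jp(g_j)` -/
  reg2 : ∀ k, k ≤ S.K → ∀ (h : Hist S.P k), Hist.Admissible 𝔠.lane.carrier.M₁ (rcolOf S 𝔠.lane.carrier) k h →
    ∀ (U : GaugeField S.P k G), ∀ j < k,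
      RegLift S j (Omega 𝔠.lane.carrier.M₁ (rcolOf S 𝔠.lane.carrier) k h j)
        (𝔠.C68 * (S.gk j * pFun 𝔠.lane.carrier.b₀ 𝔠.lane.carrier.p₀ (S.gk j))) (liftCfg 𝔊 (X.UkH k h U))

end Faces

end Summit.QuantumFields.YangMills.Theorems.BalabanUVNodesN08AlphaClassI

end
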